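import Mathlib
import Summits.KontsevichZagierPeriods.KontsevichZagierPeriods.Theorems.TorsionLogsGKZLevelThreePairTChainCubeRootA
import Summits.KontsevichZagierPeriods.KontsevichZagierPeriods.Theorems.TorsionLogsGKZLevelThreePairTChainFold
import Literature.NumberTheory.Transcendental.KZCalculus
import Literature.NumberTheory.Transcendental.KZLogCalculusProofs
import Literature.NumberTheory.Transcendental.KZDominatedFamilyRelations
import Literature.NumberTheory.Transcendental.KZSemialgebraicComplex
import Literature.NumberTheory.Transcendental.SemialgebraicMapsProofs
import Literature.NumberTheory.Transcendental.SemialgebraicRpow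
import Literature.NumberTheory.Transcendental.EllIterRep
import Literature.NumberTheory.Transcendental.KZDirichletPeeling
import Literature.NumberTheory.Transcendental.KZProductIdeal

/-!
# Route TorsionLogs — support item `GKZLevelThreePair`: the T-chain, step (N1)
# (`Trep = [(0,1)², t^{-1/3}(1-t)^{-2/3}(1-y²t)^{-1/3}] ∼ R1 = [(0,∞)×(0,1), 3/√((x³+1)²-4y²x³)]`)

Helper file for item `stmt-KontsevichZagierPeriods-13812` (`GKZLevelThreePair`), blueprint v3. The
first move of the T-chain is the change of variables `Ψ(t,y) = (R(t,y)^{1/3}, y)`,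
`R = (1-t)/(t(1-y²t))` (the hyperelliptic model `Y² = (x³+1)² - 4y²x³` of the level-3 Euler
curve), from the open unit square onto the half-strip `(0,∞)×(0,1)`; its algebra is in
`…TChainCubeRootA.lean`.  Here:

* `hasFDerivAt_cubeChartR₂`, `hasFDerivAt_cubeChartΨ`, `det_cubeChartΨ` — derivative and Jacobian;
* `cubeChartΨ_injOn`, `cubeChartΨ_image` — `Ψ` is a bijection square → half-strip;
* `euler_equivalent_R1` — the move `Trep ∼ R1` (rule (2));
* `exists_eulerRep₂` — `Trep` exists (domination by the product `t^{-1/3}(1-t)^{-2/3} ⊗ (1-y)^{-1/3}`);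
* `exists_R1` — `R1` exists (integrability transported along `Ψ`).

## References

* M. Kontsevich, D. Zagier, *Periods* (2001), §1.2 rule (2).
-/

-- `Summit.<Summit>.<Sub>` with Sub = Summit (single-conjunct summit, D-0017) duplicates the segment.
set_option linter.dupNamespace false

noncomputable section

namespace Summit.KontsevichZagierPeriods.KontsevichZagierPeriods.Theorems.GKZLevelThree

open Set MeasureTheory
open MvPolynomial (aeval X C)
open Literature.NumberTheory.Transcendental Literature.NumberTheory.Transcendental.KZ
open Literature.ModelTheory.ExponentialFields (IsSemialgebraic isSemialgebraic_setOf_eval_pos)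

/-! ## Calculus of the chart `Ψ(t,y) = (R^{1/3}, y)` -/

/-- Derivative of `(t,y) ↦ R(t,y) = (1-t)/(t(1-y²t))`:
`∂R/∂t = -(y²t²-2y²t+1)/(t²(1-y²t)²)`, `∂R/∂y = 2y(1-t)/(1-y²t)²`. -/
theorem hasFDerivAt_cubeChartR₂ (z : Fin 2 → ℝ) (ht : z 0 ≠ 0) (hzt : 1 - z 1 ^ 2 * z 0 ≠ 0) :
    HasFDerivAt (fun w : Fin 2 → ℝ => (1 - w 0) / (w 0 * (1 - w 1 ^ 2 * w 0)))
      ((-(z 1 ^ 2 * z 0 ^ 2 - 2 * z 1 ^ 2 * z 0 + 1) / (z 0 ^ 2 * (1 - z 1 ^ 2 * z 0) ^ 2)) •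
          ContinuousLinearMap.proj (R := ℝ) (φ := fun _ : Fin 2 => ℝ) 0 +
        (2 * z 1 * (1 - z 0) / (1 - z 1 ^ 2 * z 0) ^ 2) •
          ContinuousLinearMap.proj (R := ℝ) (φ := fun _ : Fin 2 => ℝ) 1) z := by
  have h0 : HasFDerivAt (fun w : Fin 2 → ℝ => w 0)
      (ContinuousLinearMap.proj (R := ℝ) (φ := fun _ : Fin 2 => ℝ) 0) z := hasFDerivAt_apply 0 z
  have h1 : HasFDerivAt (fun w : Fin 2 → ℝ => w 1)
      (ContinuousLinearMap.proj (R := ℝ) (φ := fun _ : Fin 2 => ℝ) 1) z := hasFDerivAt_apply 1 z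
  have hnum := (hasFDerivAt_const (1:ℝ) z).sub h0
  have hden := h0.mul ((hasFDerivAt_const (1:ℝ) z).sub ((h1.mul h1).mul h0))
  have hden0 : z 0 * (1 - z 1 * z 1 * z 0) ≠ 0 := by
    rw [show z 1 * z 1 = z 1 ^ 2 by ring]; exact mul_ne_zero ht hzt
  have hinv := (hasDerivAt_inv hden0).comp_hasFDerivAt z hden
  have h := hnum.mul hinv
  have hzt' : (1 - z 1 * z 1 * z 0) ≠ 0 := by rw [show z 1 * z 1 = z 1 ^ 2 by ring]; exact hzt
  refine (h.congr_fderiv ?_).congr_of_eventuallyEq (Filter.Eventually.of_forall fun w => ?_)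
  · ext v
    simp
    field_simp
    ring
  · simp [div_eq_mul_inv, sq]

/-- **The chart is differentiable**: `Ψ(t,y) = (R^{1/3}, y)` has derivative
`[c·∂R/∂t, c·∂R/∂y; 0, 1]`, `c = (1/3)R^{1/3-1}`, where `R > 0`. -/
theorem hasFDerivAt_cubeChartΨ (z : Fin 2 → ℝ) (ht : z 0 ≠ 0) (hzt : 1 - z 1 ^ 2 * z 0 ≠ 0)
    (hR : 0 < (1 - z 0) / (z 0 * (1 - z 1 ^ 2 * z 0))) :
    HasFDerivAt
      (fun w : Fin 2 → ℝ => (![((1 - w 0) / (w 0 * (1 - w 1 ^ 2 * w 0))) ^ (1 / 3 : ℝ), w 1] : Fin 2 → ℝ))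
      (LinearMap.toContinuousLinearMap (Matrix.toLin'
        !![1 / 3 * ((1 - z 0) / (z 0 * (1 - z 1 ^ 2 * z 0))) ^ ((1 / 3 : ℝ) - 1) *
              (-(z 1 ^ 2 * z 0 ^ 2 - 2 * z 1 ^ 2 * z 0 + 1) / (z 0 ^ 2 * (1 - z 1 ^ 2 * z 0) ^ 2)),
            1 / 3 * ((1 - z 0) / (z 0 * (1 - z 1 ^ 2 * z 0))) ^ ((1 / 3 : ℝ) - 1) *
              (2 * z 1 * (1 - z 0) / (1 - z 1 ^ 2 * z 0) ^ 2);
           0, 1])) z := by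
  refine hasFDerivAt_pi'.mpr fun i => ?_
  have h1 : HasFDerivAt (fun w : Fin 2 → ℝ => w 1)
      (ContinuousLinearMap.proj (R := ℝ) (φ := fun _ : Fin 2 => ℝ) 1) z := hasFDerivAt_apply 1 z
  have hx := (hasFDerivAt_cubeChartR₂ z ht hzt).rpow_const (p := (1 / 3 : ℝ)) (Or.inl hR.ne')
  fin_cases i
  · refine (hx.congr_fderiv ?_).congr_of_eventuallyEq (Filter.Eventually.of_forall fun w => by simp)
    ext v
    simp [Matrix.toLin'_apply, dotProduct, Fin.sum_univ_two]
    ring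
  · refine (h1.congr_fderiv ?_).congr_of_eventuallyEq (Filter.Eventually.of_forall fun w => by simp)
    ext v
    simp [Matrix.toLin'_apply, dotProduct, Fin.sum_univ_two]

/-- **The Jacobian** of `Ψ`: `det Ψ' = (1/3)R^{1/3-1}·∂R/∂t`. -/
theorem det_cubeChartΨ (c a b : ℝ) :
    (LinearMap.toContinuousLinearMap (Matrix.toLin' !![c * a, c * b; (0:ℝ), 1])).det = c * a := by
  show LinearMap.det (Matrix.toLin' !![c * a, c * b; (0:ℝ), 1]) = _
  rw [LinearMap.det_toLin', Matrix.det_fin_two_of]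
  ring

/-! ## `Ψ` is a bijection of the open square onto the half-strip -/

/-- On the open square `R(t,y) > 0`. -/
theorem cubeChartR₂_pos {z : Fin 2 → ℝ} (hz : (0 < z 0 ∧ z 0 < 1) ∧ (0 < z 1 ∧ z 1 < 1)) :
    0 < (1 - z 0) / (z 0 * (1 - z 1 ^ 2 * z 0)) :=
  cubeChartR_pos (by nlinarith [hz.2.1, hz.2.2]) hz.1.1 hz.1.2

/-- On the open square `1 - y²t ≠ 0`. -/
theorem one_sub_sq_mul_pos {z : Fin 2 → ℝ} (hz : (0 < z 0 ∧ z 0 < 1) ∧ (0 < z 1 ∧ z 1 < 1)) :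
    0 < 1 - z 1 ^ 2 * z 0 := by
  have hy2 : z 1 ^ 2 < 1 := by nlinarith [hz.2.1, hz.2.2]
  nlinarith [mul_lt_mul_of_pos_right hy2 hz.1.1, hz.1.2]

/-- `(R^{1/3})³ = R` for `R ≥ 0`. -/
theorem rpow_third_pow_three {R : ℝ} (hR : 0 ≤ R) : (R ^ (1 / 3 : ℝ)) ^ 3 = R := by
  rw [show (1 / 3 : ℝ) = ((3 : ℕ) : ℝ)⁻¹ by norm_num]
  exact Real.rpow_inv_natCast_pow hR (by norm_num)

/-- `Ψ` is injective on the open square (`y` is kept; `t ↦ R(t,y)` is injective). -/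
theorem cubeChartΨ_injOn :
    InjOn (fun w : Fin 2 → ℝ => (![((1 - w 0) / (w 0 * (1 - w 1 ^ 2 * w 0))) ^ (1 / 3 : ℝ), w 1] : Fin 2 → ℝ))
      {z | (0 < z 0 ∧ z 0 < 1) ∧ (0 < z 1 ∧ z 1 < 1)} := by
  intro z hz w hw h
  have h0 := congr_fun h 0
  have h1 := congr_fun h 1
  simp only [Matrix.cons_val_zero, Matrix.cons_val_one] at h0 h1
  have hy : z 1 = w 1 := h1
  have hRz := cubeChartR₂_pos hz
  have hRw := cubeChartR₂_pos hw
  have h3 : (1 - z 0) / (z 0 * (1 - z 1 ^ 2 * z 0)) = (1 - w 0) / (w 0 * (1 - w 1 ^ 2 * w 0)) := by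
    rw [← rpow_third_pow_three hRz.le, ← rpow_third_pow_three hRw.le, h0]
  rw [hy] at h3
  have hy2 : w 1 ^ 2 < 1 := by nlinarith [hw.2.1, hw.2.2]
  have ht : z 0 = w 0 :=
    cubeChartR_injective hy2 (sq_nonneg _) hz.1.1 hz.1.2 hw.1.1 hw.1.2 h3
  ext i
  fin_cases i
  · exact ht
  · exact hy

/-- `Ψ` maps the open square onto the half-strip `{0 < x} × (0,1)`. -/
theorem cubeChartΨ_image :
    (fun w : Fin 2 → ℝ => (![((1 - w 0) / (w 0 * (1 - w 1 ^ 2 * w 0))) ^ (1 / 3 : ℝ), w 1] : Fin 2 → ℝ)) ''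
      {z | (0 < z 0 ∧ z 0 < 1) ∧ (0 < z 1 ∧ z 1 < 1)} = {z | 0 < z 0 ∧ (0 < z 1 ∧ z 1 < 1)} := by
  ext x
  simp only [mem_image, mem_setOf_eq]
  constructor
  · rintro ⟨z, hz, rfl⟩
    refine ⟨?_, by simpa using hz.2⟩
    simp only [Matrix.cons_val_zero]
    exact Real.rpow_pos_of_pos (cubeChartR₂_pos hz) _
  · rintro ⟨hx0, hy0, hy1⟩
    have hy2 : x 1 ^ 2 < 1 := by nlinarith
    obtain ⟨t, ht0, ht1, ht⟩ := exists_cubeChartR_eq hy2 (sq_nonneg (x 1)) (pow_pos hx0 3)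
    refine ⟨![t, x 1], ⟨⟨by simpa using ht0, by simpa using ht1⟩, by simpa using hy0, by simpa using hy1⟩, ?_⟩
    ext i
    fin_cases i
    · show (![((1 - (![t, x 1] : Fin 2 → ℝ) 0) / ((![t, x 1] : Fin 2 → ℝ) 0 *
          (1 - (![t, x 1] : Fin 2 → ℝ) 1 ^ 2 * (![t, x 1] : Fin 2 → ℝ) 0))) ^ (1 / 3 : ℝ),
          (![t, x 1] : Fin 2 → ℝ) 1] : Fin 2 → ℝ) 0 = x 0
      simp only [Matrix.cons_val_zero, Matrix.cons_val_one]
      rw [ht, show (1 / 3 : ℝ) = ((3 : ℕ) : ℝ)⁻¹ by norm_num]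
      exact Real.pow_rpow_inv_natCast hx0.le (by norm_num)
    · simp

/-- `Ψ` is `ℚ`-semialgebraic on any `ℚ`-semialgebraic subset of the open square. -/
theorem isSemialgebraicMapOn_cubeChartΨ {S : Set (Fin 2 → ℝ)} (hS : IsSemialgebraic ℚ S)
    (hSsub : S ⊆ {z | (0 < z 0 ∧ z 0 < 1) ∧ (0 < z 1 ∧ z 1 < 1)}) :
    IsSemialgebraicMapOn ℚ S
      (fun w : Fin 2 → ℝ => (![((1 - w 0) / (w 0 * (1 - w 1 ^ 2 * w 0))) ^ (1 / 3 : ℝ), w 1] : Fin 2 → ℝ)) := by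
  have hX1 : IsSemialgebraicFunOn ℚ S (fun z => z 1) :=
    (isSemialgebraicFunOn_aeval hS (X 1 : MvPolynomial (Fin 2) ℚ)).congr fun z _ => by simp
  have hnum : IsSemialgebraicFunOn ℚ S (fun z => 1 - z 0) :=
    (isSemialgebraicFunOn_aeval hS (1 - X 0 : MvPolynomial (Fin 2) ℚ)).congr fun z _ => by simp
  have hden : IsSemialgebraicFunOn ℚ S (fun z => z 0 * (1 - z 1 ^ 2 * z 0)) :=
    (isSemialgebraicFunOn_aeval hS (X 0 * (1 - X 1 ^ 2 * X 0) : MvPolynomial (Fin 2) ℚ)).congr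
      fun z _ => by simp
  have hR : IsSemialgebraicFunOn ℚ S (fun z => (1 - z 0) / (z 0 * (1 - z 1 ^ 2 * z 0))) :=
    (hnum.div hden fun z hz => (mul_pos (hSsub hz).1.1 (one_sub_sq_mul_pos (hSsub hz))).ne').congr
      fun z _ => rfl
  have hx : IsSemialgebraicFunOn ℚ S
      (fun z => ((1 - z 0) / (z 0 * (1 - z 1 ^ 2 * z 0))) ^ (((1 / 3 : ℚ) : ℚ) : ℝ)) :=
    IsSemialgebraicFunOn.rpow_ratCast hS hR (fun z hz => cubeChartR₂_pos (hSsub hz)) (1 / 3)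
  refine IsSemialgebraicMapOn.of_forall hS fun j => ?_
  fin_cases j
  · exact hx.congr fun z _ => by simp
  · exact hX1.congr fun z _ => by simp

/-! ## The move `Trep ∼ R1` -/

/-- **The pull-back identity with the Jacobian**: on the open square,
`t^{-1/3}(1-t)^{-2/3}(1-y²t)^{-1/3} = 3/Y(x,y) · |det Ψ'(t,y)|`, `x = R^{1/3}`. -/
theorem cubeChartΨ_pullback {z : Fin 2 → ℝ} (hz : (0 < z 0 ∧ z 0 < 1) ∧ (0 < z 1 ∧ z 1 < 1)) :
    z 0 ^ (-(1:ℝ) / 3) * (1 - z 0) ^ (-(2:ℝ) / 3) * (1 - z 1 ^ 2 * z 0) ^ (-(1:ℝ) / 3) =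
      3 / Real.sqrt (((((1 - z 0) / (z 0 * (1 - z 1 ^ 2 * z 0))) ^ (1 / 3 : ℝ)) ^ 3 + 1) ^ 2 -
          4 * z 1 ^ 2 * (((1 - z 0) / (z 0 * (1 - z 1 ^ 2 * z 0))) ^ (1 / 3 : ℝ)) ^ 3) *
        |(LinearMap.toContinuousLinearMap (Matrix.toLin'
          !![1 / 3 * ((1 - z 0) / (z 0 * (1 - z 1 ^ 2 * z 0))) ^ ((1 / 3 : ℝ) - 1) *
                (-(z 1 ^ 2 * z 0 ^ 2 - 2 * z 1 ^ 2 * z 0 + 1) / (z 0 ^ 2 * (1 - z 1 ^ 2 * z 0) ^ 2)),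
              1 / 3 * ((1 - z 0) / (z 0 * (1 - z 1 ^ 2 * z 0))) ^ ((1 / 3 : ℝ) - 1) *
                (2 * z 1 * (1 - z 0) / (1 - z 1 ^ 2 * z 0) ^ 2);
             0, 1])).det| := by
  have ⟨⟨ht0, ht1⟩, ⟨hy0, hy1⟩⟩ := hz
  have hy2 : z 1 ^ 2 < 1 := by nlinarith
  have hzt : 0 < 1 - z 1 ^ 2 * z 0 := one_sub_sq_mul_pos hz
  have hR : 0 < (1 - z 0) / (z 0 * (1 - z 1 ^ 2 * z 0)) := cubeChartR₂_pos hz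
  have hN : 0 < z 1 ^ 2 * z 0 ^ 2 - 2 * z 1 ^ 2 * z 0 + 1 := cubeChart_num_pos hy2 (sq_nonneg _)
  set x : ℝ := ((1 - z 0) / (z 0 * (1 - z 1 ^ 2 * z 0))) ^ (1 / 3 : ℝ) with hx
  have hxpos : 0 < x := Real.rpow_pos_of_pos hR _
  have hx3 : x ^ 3 = (1 - z 0) / (z 0 * (1 - z 1 ^ 2 * z 0)) := rpow_third_pow_three hR.le
  -- `R^{1/3-1} = x / R`
  have hc : ((1 - z 0) / (z 0 * (1 - z 1 ^ 2 * z 0))) ^ ((1 / 3 : ℝ) - 1) =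
      x / ((1 - z 0) / (z 0 * (1 - z 1 ^ 2 * z 0))) := by
    rw [Real.rpow_sub hR, Real.rpow_one]
  have hc0 : 0 < 1 / 3 * (x / ((1 - z 0) / (z 0 * (1 - z 1 ^ 2 * z 0)))) := by positivity
  have hD0 : 0 < z 0 ^ 2 * (1 - z 1 ^ 2 * z 0) ^ 2 := by positivity
  rw [det_cubeChartΨ, hc, abs_mul, abs_of_pos hc0, abs_div, abs_neg, abs_of_pos hN, abs_of_pos hD0]
  exact cubeChart_pullback hy2 (sq_nonneg _) ht0 ht1 hxpos hx3


/-- **Step (N1)**: `Trep = [(0,1)² ∋ (t,y), t^{-1/3}(1-t)^{-2/3}(1-y²t)^{-1/3}] ∼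
R1 = [(0,∞)×(0,1) ∋ (x,y), 3/√((x³+1)²-4y²x³)]` (pinned), by the change of variables
`Ψ(t,y) = (R^{1/3}, y)`, `R = (1-t)/(t(1-y²t))`: a `ℚ`-semialgebraic bijection of the open square
onto the half-strip with `|det Ψ'| = (1/3)R^{-2/3}(y²t²-2y²t+1)/(t²(1-y²t)²)` and
`3/Y(Ψ(t,y)) · |det Ψ'| = t^{-1/3}(1-t)^{-2/3}(1-y²t)^{-1/3}` (`cubeChart_pullback`).
[Kontsevich–Zagier 2001, §1.2 rule (2)] -/
theorem euler_equivalent_R1 (T R₁ : IntegralRep 2)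
    (hTd : T.domain = {z | (0 < z 0 ∧ z 0 < 1) ∧ (0 < z 1 ∧ z 1 < 1)})
    (hTi : EqOn T.integrand (fun z => z 0 ^ (-(1:ℝ) / 3) * (1 - z 0) ^ (-(2:ℝ) / 3) *
      (1 - z 1 ^ 2 * z 0) ^ (-(1:ℝ) / 3)) T.domain)
    (h1d : R₁.domain = {z | 0 < z 0 ∧ (0 < z 1 ∧ z 1 < 1)})
    (h1i : EqOn R₁.integrand (fun z => 3 / Real.sqrt ((z 0 ^ 3 + 1) ^ 2 - 4 * z 1 ^ 2 * z 0 ^ 3)) R₁.domain) :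
    Equivalent T R₁ := by
  set Ψ : (Fin 2 → ℝ) → (Fin 2 → ℝ) :=
    fun w => (![((1 - w 0) / (w 0 * (1 - w 1 ^ 2 * w 0))) ^ (1 / 3 : ℝ), w 1] : Fin 2 → ℝ) with hΨ
  set Ψ' : (Fin 2 → ℝ) → (Fin 2 → ℝ) →L[ℝ] (Fin 2 → ℝ) := fun z =>
    LinearMap.toContinuousLinearMap (Matrix.toLin'
        !![1 / 3 * ((1 - z 0) / (z 0 * (1 - z 1 ^ 2 * z 0))) ^ ((1 / 3 : ℝ) - 1) *
              (-(z 1 ^ 2 * z 0 ^ 2 - 2 * z 1 ^ 2 * z 0 + 1) / (z 0 ^ 2 * (1 - z 1 ^ 2 * z 0) ^ 2)),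
            1 / 3 * ((1 - z 0) / (z 0 * (1 - z 1 ^ 2 * z 0))) ^ ((1 / 3 : ℝ) - 1) *
              (2 * z 1 * (1 - z 0) / (1 - z 1 ^ 2 * z 0) ^ 2);
           0, 1]) with hΨ'
  have hdom : ∀ z ∈ T.domain, (0 < z 0 ∧ z 0 < 1) ∧ (0 < z 1 ∧ z 1 < 1) := fun z hz => by rwa [hTd] at hz
  have hsa : IsSemialgebraicMapOn ℚ T.domain Ψ :=
    isSemialgebraicMapOn_cubeChartΨ T.isSemialgebraic_domain (by rw [hTd])
  have hder : ∀ z ∈ T.domain, HasFDerivWithinAt Ψ (Ψ' z) T.domain z := fun z hz =>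
    (hasFDerivAt_cubeChartΨ z (hdom z hz).1.1.ne' (one_sub_sq_mul_pos (hdom z hz)).ne'
      (cubeChartR₂_pos (hdom z hz))).hasFDerivWithinAt
  have hinj : InjOn Ψ T.domain := by rw [hTd]; exact cubeChartΨ_injOn
  have himage : R₁.domain = Ψ '' T.domain := by rw [h1d, hTd, cubeChartΨ_image]
  have hint : ∀ z ∈ T.domain, T.integrand z = R₁.integrand (Ψ z) * |(Ψ' z).det| := by
    intro z hz
    have hΨz : Ψ z ∈ R₁.domain := by rw [himage]; exact mem_image_of_mem _ hz
    rw [hTi hz, h1i hΨz]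
    exact cubeChartΨ_pullback (hdom z hz)
  exact changeOfVariablesRel_subset_relations ⟨2, T, R₁, Ψ, Ψ', hsa, hder, hinj, himage, hint, rfl⟩

/-! ## Existence of `Trep` and `R1` -/

/-- **`Trep` exists**: `[(0,1)², t^{-1/3}(1-t)^{-2/3}(1-y²t)^{-1/3}]` is an integral representation —
the integrand is `ℚ`-semialgebraic (rational powers of positive polynomials) and integrable, being
dominated on the square by the product `t^{-1/3}(1-t)^{-2/3} ⊗ (1-y)^{-1/3}` of two Beta integrands
(`1 - y²t ≥ 1 - y`). -/
theorem exists_eulerRep₂ : ∃ T : IntegralRep 2, T.domain = {z | (0 < z 0 ∧ z 0 < 1) ∧ (0 < z 1 ∧ z 1 < 1)} ∧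
    T.integrand = fun z => z 0 ^ (-(1:ℝ) / 3) * (1 - z 0) ^ (-(2:ℝ) / 3) * (1 - z 1 ^ 2 * z 0) ^ (-(1:ℝ) / 3) := by
  set S2 : Set (Fin 2 → ℝ) := {z | (0 < z 0 ∧ z 0 < 1) ∧ (0 < z 1 ∧ z 1 < 1)} with hS2
  set K : (Fin 2 → ℝ) → ℝ := fun z =>
    z 0 ^ (-(1:ℝ) / 3) * (1 - z 0) ^ (-(2:ℝ) / 3) * (1 - z 1 ^ 2 * z 0) ^ (-(1:ℝ) / 3) with hK
  have hS2s : IsSemialgebraic ℚ S2 :=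
    ((KZ.isSemialgebraic_setOf_const_lt_apply isAlgebraic_zero 0).inter
      (KZ.isSemialgebraic_setOf_apply_lt_const isAlgebraic_one 0)).inter
      ((KZ.isSemialgebraic_setOf_const_lt_apply isAlgebraic_zero 1).inter
      (KZ.isSemialgebraic_setOf_apply_lt_const isAlgebraic_one 1))
  -- semialgebraic integrand
  have hX0 : IsSemialgebraicFunOn ℚ S2 (fun z => z 0) :=
    (isSemialgebraicFunOn_aeval hS2s (X 0 : MvPolynomial (Fin 2) ℚ)).congr fun z _ => by simp
  have h1X0 : IsSemialgebraicFunOn ℚ S2 (fun z => 1 - z 0) :=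
    (isSemialgebraicFunOn_aeval hS2s (1 - X 0 : MvPolynomial (Fin 2) ℚ)).congr fun z _ => by simp
  have hW : IsSemialgebraicFunOn ℚ S2 (fun z => 1 - z 1 ^ 2 * z 0) :=
    (isSemialgebraicFunOn_aeval hS2s (1 - X 1 ^ 2 * X 0 : MvPolynomial (Fin 2) ℚ)).congr fun z _ => by simp
  have hf1 := IsSemialgebraicFunOn.rpow_ratCast hS2s hX0 (fun z hz => hz.1.1) (-1 / 3)
  have hf2 := IsSemialgebraicFunOn.rpow_ratCast hS2s h1X0 (fun z hz => sub_pos.2 hz.1.2) (-2 / 3)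
  have hf3 := IsSemialgebraicFunOn.rpow_ratCast hS2s hW (fun z hz => one_sub_sq_mul_pos hz) (-1 / 3)
  have hKs : IsSemialgebraicFunOn ℚ S2 K := by
    refine ((IsSemialgebraicFunOn.mul_holds (IsSemialgebraicFunOn.mul_holds hf1 hf2) hf3)).congr
      fun z _ => ?_
    simp only [hK]
    norm_num
  -- the dominating product of two Beta integrands
  obtain ⟨B1, hB1d, hB1i⟩ := exists_betaRep' (2 / 3) (1 / 3) (by norm_num) (by norm_num)
  obtain ⟨B2, hB2d, hB2i⟩ := exists_betaRep' 1 (2 / 3) (by norm_num) (by norm_num)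
  have e0 : (Fin.castAdd 1 (0 : Fin 1) : Fin 2) = 0 := rfl
  have e1 : (Fin.natAdd 1 (0 : Fin 1) : Fin 2) = 1 := rfl
  have hPd : (B1.prod B2).domain = S2 := by
    ext z
    simp only [IntegralRep.prod_domain, IntegralRep.mem_prodDomain, hB1d, hB2d, mem_setOf_eq, mem_Ioo,
      e0, e1, hS2]
  have hmeas : MeasurableSet S2 := hPd ▸ IntegralRep.measurableSet_domain_holds (B1.prod B2)
  have hPint : IntegrableOn (B1.prod B2).integrand S2 := hPd ▸ (B1.prod B2).integrableOn
  have hPi : ∀ z ∈ S2, (B1.prod B2).integrand z =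
      z 0 ^ (-(1:ℝ) / 3) * (1 - z 0) ^ (-(2:ℝ) / 3) * (1 - z 1) ^ (-(1:ℝ) / 3) := by
    intro z _
    rw [IntegralRep.prod_integrand_eq, IntegralRep.prodFun_apply, hB1i, hB2i]
    simp only [e0, e1]
    norm_num
  -- continuity (for measurability) and the pointwise bound
  have hc0 : ContinuousOn (fun z : Fin 2 → ℝ => z 0) S2 := (continuous_apply 0).continuousOn
  have hc1 : ContinuousOn (fun z : Fin 2 → ℝ => 1 - z 0) S2 :=
    (continuous_const.sub (continuous_apply 0)).continuousOn
  have hc2 : ContinuousOn (fun z : Fin 2 → ℝ => 1 - z 1 ^ 2 * z 0) S2 :=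
    (continuous_const.sub (((continuous_apply 1).pow 2).mul (continuous_apply 0))).continuousOn
  have hKc : ContinuousOn K S2 :=
    ((hc0.rpow_const fun z hz => Or.inl hz.1.1.ne').mul
      (hc1.rpow_const fun z hz => Or.inl (sub_pos.2 hz.1.2).ne')).mul
      (hc2.rpow_const fun z hz => Or.inl (one_sub_sq_mul_pos hz).ne')
  have hKint : IntegrableOn K S2 := by
    refine Integrable.mono' hPint (hKc.aestronglyMeasurable hmeas) ?_
    refine ae_restrict_of_forall_mem hmeas fun z hz => ?_
    have hz' : (0 < z 0 ∧ z 0 < 1) ∧ (0 < z 1 ∧ z 1 < 1) := hz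
    have hA : 0 < z 0 ^ (-(1:ℝ) / 3) * (1 - z 0) ^ (-(2:ℝ) / 3) :=
      mul_pos (Real.rpow_pos_of_pos hz'.1.1 _) (Real.rpow_pos_of_pos (sub_pos.2 hz'.1.2) _)
    have hKz : 0 ≤ K z := (mul_pos hA (Real.rpow_pos_of_pos (one_sub_sq_mul_pos hz') _)).le
    rw [Real.norm_eq_abs, abs_of_nonneg hKz, hPi z hz]
    refine mul_le_mul_of_nonneg_left ?_ hA.le
    refine Real.rpow_le_rpow_of_nonpos (sub_pos.2 hz'.2.2) ?_ (by norm_num)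
    have h1 : z 1 ^ 2 * z 0 ≤ z 1 := by nlinarith [hz'.1.1, hz'.1.2, hz'.2.1, hz'.2.2]
    linarith
  exact ⟨⟨S2, K, hS2s, hKs, hKint⟩, rfl, rfl⟩

/-- **`R1` exists** given `Trep`: the integrand `3/√((x³+1)²-4y²x³)` is `ℚ`-semialgebraic on the
half-strip, and its integrability is that of `Trep` transported along `Ψ` (Mathlib's
change-of-variables criterion). -/
theorem exists_R1 (T : IntegralRep 2) (hTd : T.domain = {z | (0 < z 0 ∧ z 0 < 1) ∧ (0 < z 1 ∧ z 1 < 1)})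
    (hTi : EqOn T.integrand (fun z => z 0 ^ (-(1:ℝ) / 3) * (1 - z 0) ^ (-(2:ℝ) / 3) *
      (1 - z 1 ^ 2 * z 0) ^ (-(1:ℝ) / 3)) T.domain) :
    ∃ R₁ : IntegralRep 2, R₁.domain = {z | 0 < z 0 ∧ (0 < z 1 ∧ z 1 < 1)} ∧
      R₁.integrand = fun z => 3 / Real.sqrt ((z 0 ^ 3 + 1) ^ 2 - 4 * z 1 ^ 2 * z 0 ^ 3) := by
  set S1 : Set (Fin 2 → ℝ) := {z | 0 < z 0 ∧ (0 < z 1 ∧ z 1 < 1)} with hS1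
  set g : (Fin 2 → ℝ) → ℝ := fun z => 3 / Real.sqrt ((z 0 ^ 3 + 1) ^ 2 - 4 * z 1 ^ 2 * z 0 ^ 3) with hg
  have hS1s : IsSemialgebraic ℚ S1 :=
    (KZ.isSemialgebraic_setOf_const_lt_apply isAlgebraic_zero 0).inter
      ((KZ.isSemialgebraic_setOf_const_lt_apply isAlgebraic_zero 1).inter
      (KZ.isSemialgebraic_setOf_apply_lt_const isAlgebraic_one 1))
  -- semialgebraic integrand
  have hgs : IsSemialgebraicFunOn ℚ S1 g := by
    have h3 : IsSemialgebraicFunOn ℚ S1 (fun _ => (3:ℝ)) :=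
      (isSemialgebraicFunOn_aeval hS1s (C 3 : MvPolynomial (Fin 2) ℚ)).congr fun z _ => by simp
    have hrad : IsSemialgebraicFunOn ℚ S1 (fun z => (z 0 ^ 3 + 1) ^ 2 - 4 * z 1 ^ 2 * z 0 ^ 3) :=
      (isSemialgebraicFunOn_aeval hS1s ((X 0 ^ 3 + 1) ^ 2 - C 4 * X 1 ^ 2 * X 0 ^ 3 : MvPolynomial (Fin 2) ℚ)).congr
        fun z _ => by simp
    have hsq : IsSemialgebraicFunOn ℚ S1 (fun z => Real.sqrt ((z 0 ^ 3 + 1) ^ 2 - 4 * z 1 ^ 2 * z 0 ^ 3)) :=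
      IsSemialgebraicFunOn.sqrt_holds hrad
    exact (h3.div hsq fun z hz => (Real.sqrt_pos.2 (radicand_pos hz.1 hz.2.1.le hz.2.2)).ne').congr
      fun z _ => rfl
  -- integrability, transported along `Ψ`
  set Ψ : (Fin 2 → ℝ) → (Fin 2 → ℝ) :=
    fun w => (![((1 - w 0) / (w 0 * (1 - w 1 ^ 2 * w 0))) ^ (1 / 3 : ℝ), w 1] : Fin 2 → ℝ) with hΨ
  set Ψ' : (Fin 2 → ℝ) → (Fin 2 → ℝ) →L[ℝ] (Fin 2 → ℝ) := fun z =>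
    LinearMap.toContinuousLinearMap (Matrix.toLin'
        !![1 / 3 * ((1 - z 0) / (z 0 * (1 - z 1 ^ 2 * z 0))) ^ ((1 / 3 : ℝ) - 1) *
              (-(z 1 ^ 2 * z 0 ^ 2 - 2 * z 1 ^ 2 * z 0 + 1) / (z 0 ^ 2 * (1 - z 1 ^ 2 * z 0) ^ 2)),
            1 / 3 * ((1 - z 0) / (z 0 * (1 - z 1 ^ 2 * z 0))) ^ ((1 / 3 : ℝ) - 1) *
              (2 * z 1 * (1 - z 0) / (1 - z 1 ^ 2 * z 0) ^ 2);
           0, 1]) with hΨ'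
  have hdom : ∀ z ∈ T.domain, (0 < z 0 ∧ z 0 < 1) ∧ (0 < z 1 ∧ z 1 < 1) := fun z hz => by rwa [hTd] at hz
  have hmeas : MeasurableSet T.domain := IntegralRep.measurableSet_domain_holds T
  have hder : ∀ z ∈ T.domain, HasFDerivWithinAt Ψ (Ψ' z) T.domain z := fun z hz =>
    (hasFDerivAt_cubeChartΨ z (hdom z hz).1.1.ne' (one_sub_sq_mul_pos (hdom z hz)).ne'
      (cubeChartR₂_pos (hdom z hz))).hasFDerivWithinAt
  have hinj : InjOn Ψ T.domain := by rw [hTd]; exact cubeChartΨ_injOn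
  have himage : Ψ '' T.domain = S1 := by rw [hTd, hS1]; exact cubeChartΨ_image
  have hint : IntegrableOn g S1 := by
    rw [← himage, integrableOn_image_iff_integrableOn_abs_det_fderiv_smul volume hmeas hder hinj g]
    refine T.integrableOn.congr_fun (fun z hz => ?_) hmeas
    rw [hTi hz, smul_eq_mul, mul_comm]
    exact cubeChartΨ_pullback (hdom z hz)
  exact ⟨⟨S1, g, hS1s, hgs, hint⟩, rfl, rfl⟩

end Summit.KontsevichZagierPeriods.KontsevichZagierPeriods.Theorems.GKZLevelThree

end
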